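import Summits.AnomalousDissipation.AnomalousDissipation.Theorems.SawtoothPulseCascadeK1LocalisedCascadeStripAverage
import Literature.Analysis.FunctionSpaces.TorusHolderSobolevEmbedding

/-!
# K1loc, line `Spectral` — S-D (thin start): SLAB AND ANTI-SLAB ENERGIES VIA WINDOW AVERAGES ALONG A REAL DIRECTION

Helper file of the prover lane on the crux `K1LocalisedCascade` (stmt-AnomalousDissipation-19491), route
`SawtoothPulseCascade` (glue seat k1loc-p3; S-B ↔ S-D hand-over).  REAL-direction version of `…DirectionalAverage` (there
`v ∈ ℤ^d`; the crux quantifies `γ ∈ [5, 8]` real, and the crest direction `(1, ±γ)` of the cells is then not a lattice vector): for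
ANY `v ∈ ℝ^d` the line window average `W_h^v θ(x) = ∫_{−h}^{h} θ(x + u·v) du` (the line `u ↦ x + u·v mod 1` need not close) has
the torus multiplier `2h·sinc(2πh·(k·v))`, `k·v = Σ_j k_j v_j ∈ ℝ` (`mFourierCoeff_lineWindowAvg`).  Hence
* **slab**: `Σ' k, [|k·v| ≤ L]·‖𝓕θ(k)‖² ≤ (πL)²·‖W^v_{1/(4L)}θ‖₂²` (`tsum_slab_le_lineWindowAvg`, Jordan);
* **anti-slab**: `Σ' k, [M ≤ |k·v|]·‖𝓕θ(k)‖² ≤ (π/(π−1))²·‖θ − M·W^v_{1/(2M)}θ‖₂²` (`tsum_antislab_le_sub_lineWindowAvg`;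
  `sinc x ≤ 1/|x| ≤ 1/π` for `|x| ≥ π`).
Use (off-cone channel of the thin-start target, `…ThinChannels`): steep modes (`13/10·|k₀| ≤ γ|k₁|`) outside the strip
(`|k₀| > L`) have `|k₀ ± γk₁| ≥ γ|k₁| − |k₀| ≥ (3/10)|k₀| > (3/10)L` for BOTH signs, so the off-cone-and-off-strip energy is an
anti-slab energy for the crest direction `v = (1, ±γ)` along which the phase-start cells are constant: it is bounded by the `L²`
deviation of `θ` from its line average over length `|v|/M` — a count of cell ends / rounding zones met along the crest.
WHAT THIS IS NOT: no statement about the cascade. [cite: Grafakos2014, Prop. 3.2.2 (6) and Prop. 3.2.7 (3)] [problem: turb]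
-/

-- `Summit.<Summit>.<Problem>`: single-conjunct summit, the duplicate namespace segment is deliberate.
set_option linter.dupNamespace false

noncomputable section

namespace Summit.AnomalousDissipation.AnomalousDissipation.Theorems.SawtoothPulseCascade.K1Start

open MeasureTheory Set Filter Topology UnitAddTorus Function
open Literature.Analysis.FunctionSpaces Literature.Analysis.FunctionSpaces.Torus

variable {d : Type*} [Fintype d]

/-! ## §1 The real line shift `u ↦ u·v` and the characters -/

omit [Fintype d] in
/-- The line shift `u ↦ (u·v_j)_j : ℝ → T^d` is continuous. [folklore] -/
theorem continuous_lineShiftReal (v : d → ℝ) :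
    Continuous fun u : ℝ => (fun j => (((u * v j : ℝ)) : UnitAddCircle) : UnitAddTorus d) :=
  continuous_pi fun _ => (AddCircle.continuous_mk' (1 : ℝ)).comp (continuous_id.mul continuous_const)

/-- **Characters on a real line**: `e_k((u·v_j)_j) = exp(2πi (k·v) u)`, `k·v = Σ_j k_j v_j ∈ ℝ`. [cite: Grafakos2014, Prop. 3.2.2 (6)] -/
theorem mFourier_lineShiftReal (k : d → ℤ) (v : d → ℝ) (u : ℝ) :
    mFourier k (fun j => (((u * v j : ℝ)) : UnitAddCircle)) =
      Complex.exp (2 * Real.pi * Complex.I * ((∑ j, (k j : ℝ) * v j : ℝ) : ℂ) * (u : ℂ)) := by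
  simp only [mFourier, ContinuousMap.coe_mk, fourier_coe_apply]
  rw [← Complex.exp_sum]
  congr 1
  have e : ∀ j ∈ (Finset.univ : Finset d), (2 * Real.pi * Complex.I * ((k j : ℤ) : ℂ) * (((u * v j : ℝ)) : ℂ) / (1 : ℝ) : ℂ) =
      (2 * Real.pi * Complex.I * u) * (((k j : ℤ) : ℂ) * ((v j : ℝ) : ℂ)) := by
    intro j _; push_cast; ring
  rw [Finset.sum_congr rfl e, ← Finset.mul_sum]
  push_cast
  ring

omit [Fintype d] in
/-- **Window integral of a character of real frequency**: `∫_{−h}^{h} e^{2πiξu} du = 2h·sinc(2πξh)` (`h > 0`, `ξ ∈ ℝ`). [folklore] -/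
theorem intervalIntegral_cexp_freq (ξ : ℝ) {h : ℝ} (hh : 0 < h) :
    ∫ u in (-h)..h, Complex.exp (2 * Real.pi * Complex.I * (ξ : ℂ) * (u : ℂ)) =
      ((2 * h * Real.sinc (2 * Real.pi * ξ * h) : ℝ) : ℂ) := by
  by_cases hξ : ξ = 0
  · subst hξ
    simp [two_mul]
  · have hπ : (Real.pi : ℂ) ≠ 0 := Complex.ofReal_ne_zero.mpr Real.pi_ne_zero
    have hξ' : (ξ : ℂ) ≠ 0 := Complex.ofReal_ne_zero.mpr hξ
    have hc : (2 * Real.pi * Complex.I * ξ : ℂ) ≠ 0 := by simp [hπ, hξ', Complex.I_ne_zero]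
    have hh' : (h : ℂ) ≠ 0 := Complex.ofReal_ne_zero.mpr hh.ne'
    have hα : (2 * Real.pi * ξ * h : ℝ) ≠ 0 := mul_ne_zero (mul_ne_zero (by positivity) hξ) hh.ne'
    rw [integral_exp_mul_complex hc, Real.sinc_of_ne_zero hα]
    have e1 : (2 * Real.pi * Complex.I * ξ : ℂ) * (h : ℝ) = ((2 * Real.pi * ξ * h : ℝ) : ℂ) * Complex.I := by
      push_cast; ring
    have e2 : (2 * Real.pi * Complex.I * ξ : ℂ) * ((-h : ℝ) : ℂ) = (-((2 * Real.pi * ξ * h : ℝ) : ℂ)) * Complex.I := by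
      push_cast; ring
    rw [e1, e2, Complex.exp_mul_I, Complex.exp_mul_I, Complex.cos_neg, Complex.sin_neg]
    rw [← Complex.ofReal_cos, ← Complex.ofReal_sin]
    push_cast
    field_simp
    ring

/-! ## §2 The line window average and its multiplier -/

omit [Fintype d] in
/-- The line window average of a continuous field is continuous. [folklore] -/
theorem continuous_lineWindowAvg {θ : UnitAddTorus d → ℂ} (hθ : Continuous θ) (v : d → ℝ) (a b : ℝ) :
    Continuous fun x : UnitAddTorus d => ∫ u in a..b, θ (x + fun j => (((u * v j : ℝ)) : UnitAddCircle)) := by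
  have hF : Continuous (uncurry fun (x : UnitAddTorus d) (u : ℝ) =>
      θ (x + fun j => (((u * v j : ℝ)) : UnitAddCircle))) :=
    hθ.comp (continuous_fst.add ((continuous_lineShiftReal v).comp continuous_snd))
  exact intervalIntegral.continuous_parametric_intervalIntegral_of_continuous' hF a b

/-- **The multiplier of the line window** (`v ∈ ℝ^d`): `𝓕(x ↦ ∫_{−h}^{h} θ(x + u·v)du)(k) = 2h·sinc(2πh(k·v))·𝓕θ(k)`,
`k·v = Σ_j k_j v_j ∈ ℝ` (`θ` continuous, `h > 0`). [cite: Grafakos2014, Prop. 3.2.2 (6)] -/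
theorem mFourierCoeff_lineWindowAvg {θ : UnitAddTorus d → ℂ} (hθ : Continuous θ) (v : d → ℝ) {h : ℝ} (hh : 0 < h)
    (k : d → ℤ) :
    mFourierCoeff (fun x : UnitAddTorus d => ∫ u in (-h)..h, θ (x + fun j => (((u * v j : ℝ)) : UnitAddCircle))) k =
      ((2 * h * Real.sinc (2 * Real.pi * (∑ j, (k j : ℝ) * v j) * h) : ℝ) : ℂ) • mFourierCoeff θ k := by
  rw [mFourierCoeff_eq_integral_volume]
  set f : ℝ → UnitAddTorus d → ℂ :=
    fun u x => mFourier (-k) x • θ (x + fun j => (((u * v j : ℝ)) : UnitAddCircle)) with hf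
  have hcont : Continuous (uncurry f) := by
    refine Continuous.smul ((mFourier (-k)).continuous.comp continuous_snd) (hθ.comp ?_)
    exact continuous_snd.add ((continuous_lineShiftReal v).comp continuous_fst)
  obtain ⟨C, hC⟩ := (isCompact_univ (X := UnitAddTorus d)).exists_bound_of_continuousOn hθ.continuousOn
  have hbound : ∀ p : ℝ × UnitAddTorus d, ‖uncurry f p‖ ≤ C := by
    rintro ⟨u, x⟩
    simp only [uncurry, hf, norm_smul]
    calc ‖mFourier (-k) x‖ * ‖θ (x + fun j => (((u * v j : ℝ)) : UnitAddCircle))‖ ≤ 1 * C :=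
          mul_le_mul (((mFourier (-k)).norm_coe_le_norm x).trans_eq mFourier_norm) (hC _ (mem_univ _))
            (norm_nonneg _) zero_le_one
      _ = C := one_mul C
  have hint : Integrable (uncurry f) ((volume.restrict (Set.uIoc (-h) h)).prod (volume : Measure (UnitAddTorus d))) := by
    rw [Set.uIoc_of_le (by linarith : -h ≤ h)]
    exact (integrable_const C).mono' hcont.aestronglyMeasurable (ae_of_all _ hbound)
  have h1 : (fun x : UnitAddTorus d => mFourier (-k) x •
      ∫ u in (-h)..h, θ (x + fun j => (((u * v j : ℝ)) : UnitAddCircle))) = fun x => ∫ u in (-h)..h, f u x := by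
    funext x
    rw [hf]
    exact (intervalIntegral.integral_smul _ _).symm
  rw [h1, ← intervalIntegral_integral_swap hint]
  have h2 : ∀ u : ℝ, ∫ x, f u x =
      Complex.exp (2 * Real.pi * Complex.I * ((∑ j, (k j : ℝ) * v j : ℝ) : ℂ) * (u : ℂ)) • mFourierCoeff θ k := by
    intro u
    rw [hf, ← mFourier_lineShiftReal k v u, ← mFourierCoeff_comp_add_right θ _ k, mFourierCoeff_eq_integral_volume]
  simp_rw [h2]
  rw [intervalIntegral.integral_smul_const, intervalIntegral_cexp_freq _ hh]

/-! ## §3 Slab energies -/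

/-- **Slab energy is controlled by the line window average**: for continuous `θ`, `v ∈ ℝ^d` and `L > 0`,
`Σ' k, [|k·v| ≤ L]·‖𝓕θ(k)‖² ≤ (πL)²·∫ ‖∫_{−1/(4L)}^{1/(4L)} θ(x + u·v) du‖² dx`. [cite: Grafakos2014, Prop. 3.2.7 (3)] -/
theorem tsum_slab_le_lineWindowAvg {θ : UnitAddTorus d → ℂ} (hθ : Continuous θ) (v : d → ℝ) {L : ℝ} (hL : 0 < L) :
    ∑' k : d → ℤ, (if |(∑ j, (k j : ℝ) * v j)| ≤ L then (1 : ℝ) else 0) * ‖mFourierCoeff θ k‖ ^ 2 ≤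
      (Real.pi * L) ^ 2 * ∫ x : UnitAddTorus d,
        ‖∫ u in (-(1 / (4 * L)))..(1 / (4 * L)), θ (x + fun j => (((u * v j : ℝ)) : UnitAddCircle))‖ ^ 2 := by
  have hh : 0 < 1 / (4 * L) := by positivity
  set W : UnitAddTorus d → ℂ :=
    fun x => ∫ u in (-(1 / (4 * L)))..(1 / (4 * L)), θ (x + fun j => (((u * v j : ℝ)) : UnitAddCircle)) with hWdef
  have hWc : Continuous W := continuous_lineWindowAvg hθ v _ _
  have hW := hasSum_sq_mFourierCoeff_of_continuous hWc
  set μ : (d → ℤ) → ℝ := fun k => 2 * (1 / (4 * L)) * Real.sinc (2 * Real.pi * (∑ j, (k j : ℝ) * v j) * (1 / (4 * L)))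
    with hμdef
  have hWk : ∀ k : d → ℤ, ‖mFourierCoeff W k‖ ^ 2 = μ k ^ 2 * ‖mFourierCoeff θ k‖ ^ 2 := by
    intro k
    have hk := mFourierCoeff_lineWindowAvg hθ v hh k
    rw [← hWdef] at hk
    rw [hk, norm_smul, mul_pow, Complex.norm_real, Real.norm_eq_abs, sq_abs]
  have hμ : ∀ k : d → ℤ, |(∑ j, (k j : ℝ) * v j)| ≤ L → 1 ≤ (Real.pi * L) ^ 2 * μ k ^ 2 := by
    intro k hk
    have hα : |2 * Real.pi * (∑ j, (k j : ℝ) * v j) * (1 / (4 * L))| ≤ Real.pi / 2 := by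
      have e : 2 * Real.pi * (∑ j, (k j : ℝ) * v j) * (1 / (4 * L)) = Real.pi / (2 * L) * (∑ j, (k j : ℝ) * v j) := by
        field_simp; ring
      rw [e, abs_mul, abs_of_pos (by positivity : (0 : ℝ) < Real.pi / (2 * L))]
      calc Real.pi / (2 * L) * |(∑ j, (k j : ℝ) * v j)| ≤ Real.pi / (2 * L) * L :=
            mul_le_mul_of_nonneg_left hk (by positivity)
        _ = Real.pi / 2 := by field_simp
    have hs := two_div_pi_le_sinc hα
    have h1 : 1 ≤ Real.pi * L * μ k := by
      have e : Real.pi * L * μ k = (Real.pi / 2) * Real.sinc (2 * Real.pi * (∑ j, (k j : ℝ) * v j) * (1 / (4 * L))) := by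
        rw [hμdef]; field_simp; ring
      rw [e]
      calc (1 : ℝ) = (Real.pi / 2) * (2 / Real.pi) := by field_simp
        _ ≤ (Real.pi / 2) * Real.sinc (2 * Real.pi * (∑ j, (k j : ℝ) * v j) * (1 / (4 * L))) :=
            mul_le_mul_of_nonneg_left hs (by positivity)
    calc (1 : ℝ) ≤ (Real.pi * L * μ k) ^ 2 := by nlinarith
      _ = (Real.pi * L) ^ 2 * μ k ^ 2 := by ring
  have hle : ∀ k : d → ℤ, (if |(∑ j, (k j : ℝ) * v j)| ≤ L then (1 : ℝ) else 0) * ‖mFourierCoeff θ k‖ ^ 2 ≤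
      (Real.pi * L) ^ 2 * ‖mFourierCoeff W k‖ ^ 2 := by
    intro k
    rw [hWk k]
    split_ifs with hk
    · calc (1 : ℝ) * ‖mFourierCoeff θ k‖ ^ 2 ≤ ((Real.pi * L) ^ 2 * μ k ^ 2) * ‖mFourierCoeff θ k‖ ^ 2 :=
            mul_le_mul_of_nonneg_right (hμ k hk) (sq_nonneg _)
        _ = _ := by ring
    · rw [zero_mul]; positivity
  have hsum2 : Summable fun k : d → ℤ => (Real.pi * L) ^ 2 * ‖mFourierCoeff W k‖ ^ 2 := hW.summable.mul_left _
  have hnn : ∀ k : d → ℤ, 0 ≤ (if |(∑ j, (k j : ℝ) * v j)| ≤ L then (1 : ℝ) else 0) * ‖mFourierCoeff θ k‖ ^ 2 :=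
    fun k => mul_nonneg (by split_ifs <;> norm_num) (sq_nonneg _)
  have hsum1 := Summable.of_nonneg_of_le hnn hle hsum2
  calc ∑' k : d → ℤ, (if |(∑ j, (k j : ℝ) * v j)| ≤ L then (1 : ℝ) else 0) * ‖mFourierCoeff θ k‖ ^ 2
      ≤ ∑' k : d → ℤ, (Real.pi * L) ^ 2 * ‖mFourierCoeff W k‖ ^ 2 := Summable.tsum_le_tsum hle hsum1 hsum2
    _ = (Real.pi * L) ^ 2 * ∫ x : UnitAddTorus d, ‖W x‖ ^ 2 := by rw [tsum_mul_left, hW.tsum_eq]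

/-! ## §4 Anti-slab energies -/

/-- **Energy far from the hyperplane `k·v = 0` is controlled by the deviation from the line average**: for continuous
`θ`, `v ∈ ℝ^d` and `M > 0`, with `h = 1/(2M)`,
`Σ' k, [M ≤ |k·v|]·‖𝓕θ(k)‖² ≤ (π/(π−1))²·∫ ‖θ(x) − M·∫_{−h}^{h} θ(x + u·v) du‖² dx`
(multiplier `1 − sinc(2πh(k·v)) ≥ 1 − 1/π` there). [cite: Grafakos2014, Prop. 3.2.7 (3)] -/
theorem tsum_antislab_le_sub_lineWindowAvg {θ : UnitAddTorus d → ℂ} (hθ : Continuous θ) (v : d → ℝ) {M : ℝ} (hM : 0 < M) :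
    ∑' k : d → ℤ, (if M ≤ |(∑ j, (k j : ℝ) * v j)| then (1 : ℝ) else 0) * ‖mFourierCoeff θ k‖ ^ 2 ≤
      (Real.pi / (Real.pi - 1)) ^ 2 * ∫ x : UnitAddTorus d,
        ‖θ x - (M : ℂ) * ∫ u in (-(1 / (2 * M)))..(1 / (2 * M)), θ (x + fun j => (((u * v j : ℝ)) : UnitAddCircle))‖ ^ 2 := by
  have hh : 0 < 1 / (2 * M) := by positivity
  have hπ1 : 0 < Real.pi - 1 := by linarith [Real.two_le_pi]
  set W : UnitAddTorus d → ℂ :=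
    fun x => ∫ u in (-(1 / (2 * M)))..(1 / (2 * M)), θ (x + fun j => (((u * v j : ℝ)) : UnitAddCircle)) with hWdef
  set D : UnitAddTorus d → ℂ := fun x => θ x - (M : ℂ) * W x with hDdef
  have hWc : Continuous W := continuous_lineWindowAvg hθ v _ _
  have hDc : Continuous D := hθ.sub (continuous_const.mul hWc)
  have hD := hasSum_sq_mFourierCoeff_of_continuous hDc
  -- the multiplier of `D` is `1 - sinc`
  have hDk : ∀ k : d → ℤ, mFourierCoeff D k =
      ((1 - Real.sinc (2 * Real.pi * (∑ j, (k j : ℝ) * v j) * (1 / (2 * M))) : ℝ) : ℂ) • mFourierCoeff θ k := by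
    intro k
    have hi1 : Integrable (fun x : UnitAddTorus d => mFourier (-k) x • θ x) volume :=
      ((mFourier (-k)).continuous.smul hθ).integrable_unitAddTorus
    have hi2 : Integrable (fun x : UnitAddTorus d => mFourier (-k) x • ((M : ℂ) * W x)) volume :=
      ((mFourier (-k)).continuous.smul (continuous_const.mul hWc)).integrable_unitAddTorus
    have e1 : mFourierCoeff D k = mFourierCoeff θ k - mFourierCoeff (fun x => (M : ℂ) * W x) k := by
      rw [hDdef]
      simp only [mFourierCoeff_eq_integral_volume, smul_sub]
      exact integral_sub hi1 hi2
    have e2 : mFourierCoeff (fun x => (M : ℂ) * W x) k = (M : ℂ) * mFourierCoeff W k := by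
      simp only [mFourierCoeff_eq_integral_volume, smul_eq_mul]
      rw [← integral_const_mul]
      refine integral_congr_ae (Eventually.of_forall fun x => ?_)
      ring
    have e3 := mFourierCoeff_lineWindowAvg hθ v hh k
    rw [← hWdef] at e3
    rw [e1, e2, e3, smul_eq_mul, smul_eq_mul]
    generalize Real.sinc (2 * Real.pi * (∑ j, (k j : ℝ) * v j) * (1 / (2 * M))) = σ
    have hM0 : (M : ℂ) ≠ 0 := by exact_mod_cast hM.ne'
    push_cast
    field_simp
  -- on the anti-slab the multiplier is at least `1 - 1/π`
  have hs : ∀ k : d → ℤ, M ≤ |(∑ j, (k j : ℝ) * v j)| →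
      1 - Real.pi⁻¹ ≤ 1 - Real.sinc (2 * Real.pi * (∑ j, (k j : ℝ) * v j) * (1 / (2 * M))) := by
    intro k hk
    have hx : Real.pi ≤ |2 * Real.pi * (∑ j, (k j : ℝ) * v j) * (1 / (2 * M))| := by
      have e : 2 * Real.pi * (∑ j, (k j : ℝ) * v j) * (1 / (2 * M)) = Real.pi / M * (∑ j, (k j : ℝ) * v j) := by
        field_simp
      rw [e, abs_mul, abs_of_pos (by positivity : (0 : ℝ) < Real.pi / M)]
      calc Real.pi = Real.pi / M * M := by field_simp
        _ ≤ Real.pi / M * |(∑ j, (k j : ℝ) * v j)| := mul_le_mul_of_nonneg_left hk (by positivity)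
    have hx0 : 2 * Real.pi * (∑ j, (k j : ℝ) * v j) * (1 / (2 * M)) ≠ 0 :=
      abs_pos.mp (lt_of_lt_of_le Real.pi_pos hx)
    have h1 := Real.sinc_le_inv_abs hx0
    have h2 : |2 * Real.pi * (∑ j, (k j : ℝ) * v j) * (1 / (2 * M))|⁻¹ ≤ Real.pi⁻¹ := inv_anti₀ Real.pi_pos hx
    linarith
  have hle : ∀ k : d → ℤ, (if M ≤ |(∑ j, (k j : ℝ) * v j)| then (1 : ℝ) else 0) * ‖mFourierCoeff θ k‖ ^ 2 ≤
      (Real.pi / (Real.pi - 1)) ^ 2 * ‖mFourierCoeff D k‖ ^ 2 := by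
    intro k
    rw [hDk k, norm_smul, mul_pow, Complex.norm_real, Real.norm_eq_abs, sq_abs]
    generalize hσ : Real.sinc (2 * Real.pi * (∑ j, (k j : ℝ) * v j) * (1 / (2 * M))) = σ
    split_ifs with hk
    · have h1 : 1 - Real.pi⁻¹ ≤ 1 - σ := hσ ▸ hs k hk
      have h3 : 1 ≤ (Real.pi / (Real.pi - 1)) * (1 - σ) := by
        have e : (Real.pi / (Real.pi - 1)) * (1 - Real.pi⁻¹) = 1 := by
          field_simp
        calc (1 : ℝ) = (Real.pi / (Real.pi - 1)) * (1 - Real.pi⁻¹) := e.symm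
          _ ≤ (Real.pi / (Real.pi - 1)) * (1 - σ) := mul_le_mul_of_nonneg_left h1 (by positivity)
      have h4 : (1 : ℝ) ≤ ((Real.pi / (Real.pi - 1)) * (1 - σ)) ^ 2 := by nlinarith
      calc (1 : ℝ) * ‖mFourierCoeff θ k‖ ^ 2 ≤ ((Real.pi / (Real.pi - 1)) * (1 - σ)) ^ 2 * ‖mFourierCoeff θ k‖ ^ 2 :=
            mul_le_mul_of_nonneg_right h4 (sq_nonneg _)
        _ = _ := by ring
    · rw [zero_mul]; positivity
  have hsum2 : Summable fun k : d → ℤ => (Real.pi / (Real.pi - 1)) ^ 2 * ‖mFourierCoeff D k‖ ^ 2 := hD.summable.mul_left _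
  have hnn : ∀ k : d → ℤ, 0 ≤ (if M ≤ |(∑ j, (k j : ℝ) * v j)| then (1 : ℝ) else 0) * ‖mFourierCoeff θ k‖ ^ 2 :=
    fun k => mul_nonneg (by split_ifs <;> norm_num) (sq_nonneg _)
  have hsum1 := Summable.of_nonneg_of_le hnn hle hsum2
  calc ∑' k : d → ℤ, (if M ≤ |(∑ j, (k j : ℝ) * v j)| then (1 : ℝ) else 0) * ‖mFourierCoeff θ k‖ ^ 2
      ≤ ∑' k : d → ℤ, (Real.pi / (Real.pi - 1)) ^ 2 * ‖mFourierCoeff D k‖ ^ 2 := Summable.tsum_le_tsum hle hsum1 hsum2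
    _ = (Real.pi / (Real.pi - 1)) ^ 2 * ∫ x : UnitAddTorus d, ‖D x‖ ^ 2 := by rw [tsum_mul_left, hD.tsum_eq]

/-! ## §5 The off-cone channel is a strip plus an anti-slab for the crest direction (`d = 2`) -/

/-- **Steep modes off the strip are far from the crest hyperplane**: for `a ≥ 1`, `|σ| = 1` and any `γ, L'`,
`[a|k₀| ≤ γ|k₁|] ≤ [|k₀| ≤ L'] + [(a−1)L' ≤ |k₀ + σγk₁|]` (`|k₀ + σγk₁| ≥ γ|k₁| − |k₀| ≥ (a−1)|k₀|`). [folklore] -/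
theorem cone_indicator_le_strip_add_antislab (γ σ : ℝ) {a : ℝ} (L' : ℝ) (ha : 1 ≤ a) (hσ : |σ| = 1) (k : Fin 2 → ℤ) :
    (if a * |((k 0 : ℤ) : ℝ)| ≤ γ * |((k 1 : ℤ) : ℝ)| then (1 : ℝ) else 0) ≤
      (if |((k 0 : ℤ) : ℝ)| ≤ L' then (1 : ℝ) else 0) +
        (if (a - 1) * L' ≤ |∑ j, (k j : ℝ) * (![1, σ * γ] : Fin 2 → ℝ) j| then (1 : ℝ) else 0) := by
  have hsum : ∑ j, (k j : ℝ) * (![1, σ * γ] : Fin 2 → ℝ) j = ((k 0 : ℤ) : ℝ) + ((k 1 : ℤ) : ℝ) * (σ * γ) := by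
    simp [Fin.sum_univ_two]
  rw [hsum]
  by_cases hc : a * |((k 0 : ℤ) : ℝ)| ≤ γ * |((k 1 : ℤ) : ℝ)|
  · by_cases hs : |((k 0 : ℤ) : ℝ)| ≤ L'
    · rw [if_pos hc, if_pos hs]; split_ifs <;> norm_num
    · have hfar : (a - 1) * L' ≤ |((k 0 : ℤ) : ℝ) + ((k 1 : ℤ) : ℝ) * (σ * γ)| := by
        have h1 : |((k 1 : ℤ) : ℝ) * (σ * γ)| = |γ| * |((k 1 : ℤ) : ℝ)| := by
          rw [abs_mul, abs_mul, hσ, one_mul, mul_comm]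
        have h2 : |((k 1 : ℤ) : ℝ) * (σ * γ)| - |((k 0 : ℤ) : ℝ)| ≤ |((k 0 : ℤ) : ℝ) + ((k 1 : ℤ) : ℝ) * (σ * γ)| := by
          have h := abs_sub_abs_le_abs_sub (((k 1 : ℤ) : ℝ) * (σ * γ)) (-((k 0 : ℤ) : ℝ))
          rwa [abs_neg, sub_neg_eq_add, add_comm] at h
        have h3 : γ * |((k 1 : ℤ) : ℝ)| ≤ |γ| * |((k 1 : ℤ) : ℝ)| := mul_le_mul_of_nonneg_right (le_abs_self γ) (abs_nonneg _)
        have h4 : (a - 1) * L' ≤ (a - 1) * |((k 0 : ℤ) : ℝ)| := mul_le_mul_of_nonneg_left (le_of_not_ge hs) (by linarith)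
        nlinarith
      rw [if_pos hc, if_neg hs, if_pos hfar]; norm_num
  · rw [if_neg hc]; split_ifs <;> norm_num

/-- **Off-cone channel ≤ strip + anti-slab** (weighted form): for nonnegative summable `c`, `a ≥ 1`, `|σ| = 1`,
`Σ' [a|k₀| ≤ γ|k₁|]·c ≤ Σ' [|k₀| ≤ L']·c + Σ' [(a−1)L' ≤ |k·(1, σγ)|]·c`. [folklore] -/
theorem tsum_cone_le_strip_add_antislab (γ σ : ℝ) {a : ℝ} (L' : ℝ) (ha : 1 ≤ a) (hσ : |σ| = 1) {c : (Fin 2 → ℤ) → ℝ}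
    (hc : Summable c) (hc0 : ∀ k, 0 ≤ c k) :
    ∑' k : Fin 2 → ℤ, (if a * |((k 0 : ℤ) : ℝ)| ≤ γ * |((k 1 : ℤ) : ℝ)| then (1 : ℝ) else 0) * c k ≤
      ∑' k : Fin 2 → ℤ, (if |((k 0 : ℤ) : ℝ)| ≤ L' then (1 : ℝ) else 0) * c k +
        ∑' k : Fin 2 → ℤ, (if (a - 1) * L' ≤ |∑ j, (k j : ℝ) * (![1, σ * γ] : Fin 2 → ℝ) j| then (1 : ℝ) else 0) * c k := by
  have hsI : ∀ (p : (Fin 2 → ℤ) → Prop) [DecidablePred p], Summable fun k => (if p k then (1 : ℝ) else 0) * c k := by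
    intro p _
    refine Summable.of_nonneg_of_le (fun k => mul_nonneg (by split_ifs <;> norm_num) (hc0 k)) (fun k => ?_) hc
    split_ifs <;> simp [hc0 k]
  have h1 := hsI (fun k => |((k 0 : ℤ) : ℝ)| ≤ L')
  have h2 := hsI (fun k => (a - 1) * L' ≤ |∑ j, (k j : ℝ) * (![1, σ * γ] : Fin 2 → ℝ) j|)
  rw [← (h1.hasSum.add h2.hasSum).tsum_eq]
  refine Summable.tsum_le_tsum (fun k => ?_) (hsI _) (h1.add h2)
  rw [← add_mul]
  exact mul_le_mul_of_nonneg_right (cone_indicator_le_strip_add_antislab γ σ L' ha hσ k) (hc0 k)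

/-- **Off-cone channel of a continuous field on `T²`**: for `a > 1`, `L' > 0`, `|σ| = 1`, with `M = (a−1)L'` and the crest
direction `v = (1, σγ)`,
`Σ' [a|k₀| ≤ γ|k₁|]·‖𝓕θ(k)‖² ≤ Σ' [|k₀| ≤ L']·‖𝓕θ(k)‖² + (π/(π−1))²·∫ ‖θ(x) − M·∫_{−1/(2M)}^{1/(2M)} θ(x + u·v) du‖² dx`:
the steep energy is a strip energy plus the `L²` deviation of `θ` from its line average along the crest.
[cite: Grafakos2014, Prop. 3.2.7 (3)] -/
theorem tsum_cone_le_strip_add_lineDeviation {θ : UnitAddTorus (Fin 2) → ℂ} (hθ : Continuous θ) (γ σ : ℝ) {a L' : ℝ}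
    (ha : 1 < a) (hL' : 0 < L') (hσ : |σ| = 1) :
    ∑' k : Fin 2 → ℤ, (if a * |((k 0 : ℤ) : ℝ)| ≤ γ * |((k 1 : ℤ) : ℝ)| then (1 : ℝ) else 0) * ‖mFourierCoeff θ k‖ ^ 2 ≤
      ∑' k : Fin 2 → ℤ, (if |((k 0 : ℤ) : ℝ)| ≤ L' then (1 : ℝ) else 0) * ‖mFourierCoeff θ k‖ ^ 2 +
        (Real.pi / (Real.pi - 1)) ^ 2 * ∫ x : UnitAddTorus (Fin 2),
          ‖θ x - (((a - 1) * L' : ℝ) : ℂ) * ∫ u in (-(1 / (2 * ((a - 1) * L'))))..(1 / (2 * ((a - 1) * L'))),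
            θ (x + fun j => (((u * (![1, σ * γ] : Fin 2 → ℝ) j : ℝ)) : UnitAddCircle))‖ ^ 2 := by
  have hM : 0 < (a - 1) * L' := mul_pos (by linarith) hL'
  have hsq := hasSum_sq_mFourierCoeff_of_continuous hθ
  calc _ ≤ ∑' k : Fin 2 → ℤ, (if |((k 0 : ℤ) : ℝ)| ≤ L' then (1 : ℝ) else 0) * ‖mFourierCoeff θ k‖ ^ 2 +
        ∑' k : Fin 2 → ℤ, (if (a - 1) * L' ≤ |∑ j, (k j : ℝ) * (![1, σ * γ] : Fin 2 → ℝ) j| then (1 : ℝ) else 0) *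
          ‖mFourierCoeff θ k‖ ^ 2 :=
        tsum_cone_le_strip_add_antislab γ σ L' ha.le hσ hsq.summable (fun k => sq_nonneg _)
    _ ≤ _ := by
        gcongr
        exact tsum_antislab_le_sub_lineWindowAvg hθ (![1, σ * γ] : Fin 2 → ℝ) hM

/-- **Off-cone channel of a continuous REAL field** (real form of `tsum_cone_le_strip_add_lineDeviation`, the shape
consumed by `K1Ledger.From.k1Localised_of_thin_strip_cone`): for `a > 1`, `L′ > 0`, `|σ| = 1`, `M = (a−1)L′`,
`Σ'[a|k₀| ≤ γ|k₁|]‖𝓕θ‖² ≤ Σ'[|k₀| ≤ L′]‖𝓕θ‖² + (π/(π−1))²∫(θ(x) − M∫_{−1/(2M)}^{1/(2M)} θ(x + u(1,σγ))du)²dx`.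
[cite: Grafakos2014, Prop. 3.2.7 (3)] -/
theorem tsum_cone_real_le_strip_add_lineDeviation {θ : UnitAddTorus (Fin 2) → ℝ} (hθ : Continuous θ) (γ σ : ℝ)
    {a L' : ℝ} (ha : 1 < a) (hL' : 0 < L') (hσ : |σ| = 1) :
    ∑' k : Fin 2 → ℤ, (if a * |((k 0 : ℤ) : ℝ)| ≤ γ * |((k 1 : ℤ) : ℝ)| then (1 : ℝ) else 0) *
        ‖mFourierCoeff (fun x => (θ x : ℂ)) k‖ ^ 2 ≤
      ∑' k : Fin 2 → ℤ, (if |((k 0 : ℤ) : ℝ)| ≤ L' then (1 : ℝ) else 0) * ‖mFourierCoeff (fun x => (θ x : ℂ)) k‖ ^ 2 +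
        (Real.pi / (Real.pi - 1)) ^ 2 * ∫ x : UnitAddTorus (Fin 2),
          (θ x - (a - 1) * L' * ∫ u in (-(1 / (2 * ((a - 1) * L'))))..(1 / (2 * ((a - 1) * L'))),
            θ (x + fun j => (((u * (![1, σ * γ] : Fin 2 → ℝ) j : ℝ)) : UnitAddCircle))) ^ 2 := by
  have hθc : Continuous (fun x => (θ x : ℂ)) := Complex.continuous_ofReal.comp hθ
  have h := tsum_cone_le_strip_add_lineDeviation hθc γ σ ha hL' hσ
  have e : ∀ x : UnitAddTorus (Fin 2), ‖(θ x : ℂ) - (((a - 1) * L' : ℝ) : ℂ) *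
      ∫ u in (-(1 / (2 * ((a - 1) * L'))))..(1 / (2 * ((a - 1) * L'))),
        ((θ (x + fun j => (((u * (![1, σ * γ] : Fin 2 → ℝ) j : ℝ)) : UnitAddCircle)) : ℝ) : ℂ)‖ ^ 2 =
      (θ x - (a - 1) * L' * ∫ u in (-(1 / (2 * ((a - 1) * L'))))..(1 / (2 * ((a - 1) * L'))),
        θ (x + fun j => (((u * (![1, σ * γ] : Fin 2 → ℝ) j : ℝ)) : UnitAddCircle))) ^ 2 := by
    intro x
    rw [intervalIntegral.integral_ofReal, ← Complex.ofReal_mul, ← Complex.ofReal_sub, Complex.norm_real,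
      Real.norm_eq_abs, sq_abs]
  simp_rw [e] at h
  exact h

end Summit.AnomalousDissipation.AnomalousDissipation.Theorems.SawtoothPulseCascade.K1Start
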